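/-
Copyright (c) 2026 the pub-hodgecm-mathlib formalisation cell (harness21).  Prover seat hodgecm-mathlib-F0P2-p10 (g4), Track B ∕ R90-TF, h413 = `stmt-HodgeConjecture-24833`,
R90-TF section S8 «ContSpec-n½», socket (E) :276, E1-PLANCHEREL BODY, letter `hFub` piece (c1) (S8 dealer R90-CS-plan (g4) S8-R285; joint census `R90/S8/CENSUS-PlancherelBody-bricks.K2E1-p16-F0P2-p10.md` §PB-1):
THE SECOND FUBINI SWAP `G(𝔸) × {Re w = c₀ > 2}` for the intertwined bracket — `∫ β•((f∘H)φ·conj(r•(2π)⁻¹∫_ℝ f̃′(w)·𝓘_w dy)) dν_G = r(2π)⁻¹·∫_ℝ (∫ β•((f∘H)φ·conj 𝓘_w) dν_G)·conj f̃′(w) dy`, the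
product-form majorant `β|f(H)|H^{2−c₀} × |f̃′(w)|` coming from the radial `L¹` lemma (★ (δ)₃ `[0,∞]`) and the `z`-uniform bound of the intertwined coefficient (★ K2E1-p11∕p14).
-/
import Summits.HodgeConjecture.HodgeConjecture.Theorems.K2E1ChiIntertwinedSliceBracketCMThree           -- ★ hFub-c2∕c3 p865445 (brings ★ PB-1b, ★ C4a, ★ KMax estate, ★ A)
import Summits.HodgeConjecture.HodgeConjecture.Theorems.K2E1ChiOrbitalIntegralFubiniCMThree            -- ★ hFub-b p865376 (the first Fubini; brings ★ C2, ★ `K2E1HeisenbergHaarU3`)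
import Summits.HodgeConjecture.HodgeConjecture.Theorems.K2E1IntertwinedCoeffContinuousCM               -- ★ `norm_intertwinedCoeff_le_uniform_cm_three` (the `z`-uniform bound)
import Summits.HodgeConjecture.HodgeConjecture.Theorems.K2E1ChiPseudoEisensteinIdeleSplitCMThree       -- ★ C3 §4 `setLIntegral_normSq_inv_mul_enorm_comp_lt_top`
import Summits.HodgeConjecture.HodgeConjecture.Theorems.K2E1ChiSectionTorusAverageU3                  -- ★ `borelHeight_torus_mul_maximalCompact_three`
import Literature.NumberTheory.Automorphic.UnitaryGroupIwasawaIntegration                               -- ★ `isCompact_comap_adelicVal_standardMaximalCompactGL`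
import Literature.NumberTheory.Automorphic.UnitaryGroupIwasawaAdelic                                    -- ★ `exists_mem_borelAdelic_mul_mem_standardMaximalCompactGL_cm`
import HarnessLib

/-!
# hFub-c1 — `K2E1ChiPseudoEisensteinBracketTwoFubiniCMThree`: THE SECOND FUBINI SWAP `G(𝔸) × {Re w = c₀}` FOR THE INTERTWINED BRACKET `[Ψ₂]_β` ON `U(2,1)`

Track B ∕ R90-TF, crux h413 = `stmt-HodgeConjecture-24833`, route of record `HCCMUnconditional`; cell `hodgecm-mathlib`, R90-TF programme, section S8 «ContSpec-n½», socket (E)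
(B ED. 7 :276), E1-PLANCHEREL BODY.  By ★ hFub-b p865376, `CT θ′(g) − f′(Hg)φ′(g) = r•((2π)⁻¹∫_ℝ mellin f′(−w)·𝓘_w(g) dy)` (`r = (ν𝓕)⁻¹`, `w = c₀ + iy`, `c₀ > 2`,
`𝓘_w(g) = ∫_{N(𝔸)} f′^{φ′}_w(w₀vg) dν`), so `[Ψ₂]_β = ∫ β•((f∘H)φ·conj(r•(2π)⁻¹∫ mellin f′(−w)·𝓘_w dy)) dν_G`; ★ hFub-c2∕c3 p865445 evaluates the `w`-slices
`S_w = ∫ β•((f∘H)φ·conj 𝓘_w) dν_G`.  THIS FILE swaps `∫_{G(𝔸)}` and `∫_ℝ` (§5), so that `[Ψ₂]_β = r(2π)⁻¹·∫_ℝ S_w·conj(mellin f′(−w)) dy`; the assembly with the slices is the next file.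
THEOREMS ONLY (no `def`, no `instance`, no notation, no named-fact hypothesis, no `sorry`; default heartbeats); lane `--supports stmt-HodgeConjecture-24833 --as helper` (count-neutral).

THE MATHEMATICS ([MoeglinWaldspurger1995] II.1.5–II.1.7, II.2.1; [Rogawski1990] §7.3).  The two-variable integrand is
`Φ(g,y) := β(g)•((f∘H)φ(g)·conj 𝓘_{w_y}(g))·conj mellin f′(−w_y)`.  MAJORANT (§3–§4): `𝓘_w(g) = 𝓜̃_w(g)·H(g)^{2−w}` (★ `flatSectionU_intertwinedCoeff_three_eq`) with
`‖𝓜̃_w(g)‖ ≤ C_{φ′}·c(c₀)` UNIFORMLY in `Im w` and `g` (★ `norm_intertwinedCoeff_le_uniform_cm_three`), so `‖𝓘_w(g)‖ ≤ C·H(g)^{2−c₀}` and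
`‖Φ(g,y)‖ ≤ β(g)·‖f₂(Hg)‖ · C_φ C · ‖mellin f′(−w_y)‖` with `f₂(r) := r^{2−c₀}f(r) ∈ C_c((0,∞))` — a PRODUCT of `g ↦ β(g)‖f₂(Hg)‖ ∈ L¹(ν_G)` (§1: ★ (δ)₃ `[0,∞]`-identity with the
RADIAL `Ψ = ‖f₂∘H‖ₑ`, whose `K_U`-average is trivial, + ★ C3 §4 `setLIntegral_normSq_inv_mul_enorm_comp_lt_top`) and `y ↦ ‖mellin f′(−w_y)‖ ∈ L¹(dy)` (★ A `verticalIntegrable_mellin`,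
`f′ ∈ C²_c`).  MEASURABILITY (§2): `(g,y) ↦ 𝓘_{w_y}(g)` is a parametric integral of a continuous integrand on `(G(𝔸) × ℝ) × N(𝔸)` (Mathlib `StronglyMeasurable.integral_prod_right'`).
Hence `Φ ∈ L¹(ν_G ⊗ dy)` and `integral_integral_swap` gives §5.

HONEST LABEL.  Piece (c1) of one named letter; the assembly (next file) then closes `hFub` in the strict self-dual and the non-self-associate cases; pays nothing at the (E) socket.
HC_CM is proved only modulo the 7 printed citations (2 remaining named inputs: hLiu418 = `stmt-HodgeConjecture-24832`, h413 = `stmt-HodgeConjecture-24833`) until rung 0 closes; count-neutral.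
-/

set_option autoImplicit false
set_option linter.dupNamespace false  -- the mandated namespace repeats the summit's segment (`HodgeConjecture.HodgeConjecture`)

noncomputable section

open MeasureTheory Measure Set Filter Topology Complex NumberField IsDedekindDomain MulAction Function
open scoped Real NNReal ENNReal ComplexConjugate
open Literature.MeasureTheory.Group Literature.NumberTheory
open Literature.NumberTheory.Automorphic Literature.NumberTheory.Automorphic.UnitaryGroup AdelicGroupData
open Literature.NumberTheory.GaloisRepresentations (HeckeCharacter ideleGroup)
open Literature.NumberTheory.Automorphic.Arthur2013.Leaves.TECR
open Summit.HodgeConjecture.HodgeConjecture.Cruxes.H413.K2E1BorelEisensteinU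
open Summit.HodgeConjecture.HodgeConjecture.Cruxes.H413.K2E1CharacterEisensteinU2Defs
open Summit.HodgeConjecture.HodgeConjecture.Cruxes.H413.K2E1CharacterEisensteinU3PairDefs
open Summit.HodgeConjecture.HodgeConjecture.Cruxes.H413.K2E1MellinPaleyWienerHalfLine (continuous_ofReal_cpow_mul differentiable_mellin verticalIntegrable_mellin continuousOn_cpow_two)
open Summit.HodgeConjecture.HodgeConjecture.Cruxes.H413.K2E1ChiIntertwinedSectionU3 (flatSectionU_intertwinedCoeff_three_eq)
open Summit.HodgeConjecture.HodgeConjecture.Cruxes.H413.K2E1IntertwinedCoeffContinuousCM (norm_intertwinedCoeff_le_uniform_cm_three)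
open Summit.HodgeConjecture.HodgeConjecture.Cruxes.H413.K2E1EisensteinPairingUnfoldedWeight (exists_integral_weight_smul_eq_mul_setIntegral_ideleClass_three)
open Summit.HodgeConjecture.HodgeConjecture.Cruxes.H413.K2E1ChiSectionTorusAverageU3 (borelHeight_torus_mul_maximalCompact_three)
open Summit.HodgeConjecture.HodgeConjecture.Cruxes.H413.K2E1ChiPseudoEisensteinIdeleSplitCMThree (setLIntegral_normSq_inv_mul_enorm_comp_lt_top)
open Summit.HodgeConjecture.HodgeConjecture.Cruxes.H413.K2E1HeisenbergHaarU3 (isInvInvariant_of_isHaarMeasure_adelicUnipotent_three locallyCompactSpace_and_secondCountableTopology_adelicUnipotent)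

namespace Summit.HodgeConjecture.HodgeConjecture.Cruxes.H413.K2E1ChiPseudoEisensteinBracketTwoFubiniCMThree

variable (L : Type) [Field L] [NumberField L] [IsCMField L]
variable [MeasurableSpace (quasiSplit (↥(maximalRealSubfield L)) L (IsCMField.complexConj L) 3).Adelic] [BorelSpace (quasiSplit (↥(maximalRealSubfield L)) L (IsCMField.complexConj L) 3).Adelic]
variable [MeasurableSpace (AdeleRing (𝓞 L) L)ˣ] [BorelSpace (AdeleRing (𝓞 L) L)ˣ]

/-! ## §1 The radial `L¹` lemma: `g ↦ β(g)·‖f(Hg)‖ ∈ L¹(ν_G)` for `f ∈ C_c((0,∞))` -/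

/-- **`g ↦ β(g)·‖f(H g)‖` IS INTEGRABLE ON `G(𝔸)`** for a covering weight `β` of `B(L⁺)♯` and `f ∈ C_c((0,∞))`: ★ (δ)₃'s `[0,∞]`-identity with the RADIAL `Ψ = ‖f∘H‖ₑ` (left-`N(𝔸)`- and
left-`B(L⁺)`-invariant, `K_U`-average `μ_K(K_U)·‖f(‖d₀t‖)‖ₑ` by ★ `borelHeight_torus_mul_maximalCompact_three`) and ★ C3 §4 `setLIntegral_normSq_inv_mul_enorm_comp_lt_top`; the plumbing of
★ C4b's `L¹` letter, exported. [cite: Rogawski1990, §7.3 (pp. 96–98)] [cite: MoeglinWaldspurger1995, II.1.5] -/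
theorem integrable_weight_mul_norm_comp_borelHeight_cm_three
    (νG : Measure (quasiSplit (↥(maximalRealSubfield L)) L (IsCMField.complexConj L) 3).Adelic) [νG.IsHaarMeasure] (μK : Measure ((standardMaximalCompactGL 3 L).comap (adelicVal (↥(maximalRealSubfield L)) L (IsCMField.complexConj L) 3 ((StdForm.antidiagonal 3).over L)) : Subgroup (quasiSplit (↥(maximalRealSubfield L)) L (IsCMField.complexConj L) 3).Adelic)) [μK.IsHaarMeasure] (νI : Measure (AdeleRing (𝓞 L) L)ˣ) [νI.IsHaarMeasure]
    {𝓕I : Set (AdeleRing (𝓞 L) L)ˣ} (h𝓕I : IsIdeleClassDomain L 𝓕I)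
    {β : (quasiSplit (↥(maximalRealSubfield L)) L (IsCMField.complexConj L) 3).Adelic → ℝ≥0∞} (hβ : IsCoveringWeight ((arithmeticBorel (↥(maximalRealSubfield L)) L (IsCMField.complexConj L) 3).map (quasiSplit (↥(maximalRealSubfield L)) L (IsCMField.complexConj L) 3).arithmeticSubgroup.subtype) β)
    {f : ℝ → ℂ} (hf : Continuous f) (hfs : HasCompactSupport f) (hf0 : tsupport f ⊆ Ioi 0) :
    Integrable (fun g : (quasiSplit (↥(maximalRealSubfield L)) L (IsCMField.complexConj L) 3).Adelic => (β g).toReal * ‖f (borelHeight g : ℝ)‖) νG := by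
  haveI := t2Space_adeleRing_of_numberField L
  haveI := locallyCompactSpace_adeleRing' L
  have hc : IsCMField.complexConj L * IsCMField.complexConj L = 1 := AlgEquiv.ext fun x => IsCMField.complexConj_apply_apply L x
  have hc1 : IsCMField.complexConj L ≠ 1 := IsCMField.complexConj_ne_one L
  have h2 := Algebra.IsQuadraticExtension.finrank_eq_two (↥(maximalRealSubfield L)) L
  have hBK := exists_mem_borelAdelic_mul_mem_standardMaximalCompactGL_cm L (N := 3)
  have hKc : IsCompact ((((standardMaximalCompactGL 3 L).comap (adelicVal (↥(maximalRealSubfield L)) L (IsCMField.complexConj L) 3 ((StdForm.antidiagonal 3).over L)) : Subgroup (quasiSplit (↥(maximalRealSubfield L)) L (IsCMField.complexConj L) 3).Adelic)) : Set (quasiSplit (↥(maximalRealSubfield L)) L (IsCMField.complexConj L) 3).Adelic) := isCompact_comap_adelicVal_standardMaximalCompactGL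
  haveI : CompactSpace ((standardMaximalCompactGL 3 L).comap (adelicVal (↥(maximalRealSubfield L)) L (IsCMField.complexConj L) 3 ((StdForm.antidiagonal 3).over L)) : Subgroup (quasiSplit (↥(maximalRealSubfield L)) L (IsCMField.complexConj L) 3).Adelic) := isCompact_iff_compactSpace.1 hKc
  haveI : IsFiniteMeasure μK := CompactSpace.isFiniteMeasure
  obtain ⟨K, -, hKt, hδ0, -⟩ := exists_integral_weight_smul_eq_mul_setIntegral_ideleClass_three h2 hc hc1 νG μK νI hBK h𝓕I
  have hIc : Continuous fun x : (AdeleRing (𝓞 L) L)ˣ => (IdeleClassGroup.ideleNorm L x : ℝ) := NNReal.continuous_coe.comp (continuous_ideleNorm_holds L)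
  have hHc : Continuous fun g : (quasiSplit (↥(maximalRealSubfield L)) L (IsCMField.complexConj L) 3).Adelic => (borelHeight g : ℝ) := NNReal.continuous_coe.comp continuous_borelHeight
  have hfm : Measurable fun g : (quasiSplit (↥(maximalRealSubfield L)) L (IsCMField.complexConj L) 3).Adelic => f (borelHeight g : ℝ) := (hf.comp hHc).measurable
  have hHtk := borelHeight_torus_mul_maximalCompact_three (F := ↥(maximalRealSubfield L)) (E := L) (c := IsCMField.complexConj L)
  have hL1r : ∫⁻ g, β g * ‖f (borelHeight g : ℝ)‖ₑ ∂νG < ∞ := by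
    have hL := hδ0 β hβ (fun g => ‖f (borelHeight g : ℝ)‖ₑ) hfm.enorm
      (fun n y => by simp only [borelHeight_unipotent_mul ((mem_unipotentInBorel_iff _).1 n.2)])
      (fun b hb y => by simp only [K2E1TruncatedEisensteinExplicit.borelHeight_arithmeticBorel_mul hb])
      (fun x => ‖f (IdeleClassGroup.ideleNorm L x : ℝ)‖ₑ * μK Set.univ) ((hf.comp hIc).measurable.enorm.mul_const _)
      (fun k hk x => by simp only [map_mul, ideleNorm_principal hk, one_mul]) (fun t => by simp_rw [hHtk t]; exact lintegral_const _)
    rw [hL]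
    exact ENNReal.mul_lt_top hKt.lt_top (setLIntegral_normSq_inv_mul_enorm_comp_lt_top νI h𝓕I hf hfs hf0 (measure_ne_top μK _))
  refine ⟨(hβ.measurable.ennreal_toReal.mul (hf.comp hHc).norm.measurable).aestronglyMeasurable, lt_of_le_of_lt (lintegral_mono fun g => ?_) hL1r⟩
  rw [enorm_mul, Real.enorm_eq_ofReal ENNReal.toReal_nonneg, Real.enorm_eq_ofReal (norm_nonneg _), ofReal_norm]
  exact mul_le_mul' ENNReal.ofReal_toReal_le le_rfl

/-! ## §2 Joint measurability of `(g, y) ↦ 𝓘_{c₀+iy}(g)` -/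

omit [MeasurableSpace (AdeleRing (𝓞 L) L)ˣ] [BorelSpace (AdeleRing (𝓞 L) L)ˣ] in
/-- **`(g,y) ↦ 𝓘_{c₀+iy}(g) = ∫_N f′^{φ′}_{c₀+iy}(w₀vg) dν` is measurable on `G(𝔸) × ℝ`** (`φ′` continuous): the integrand is continuous on `(G(𝔸) × ℝ) × N(𝔸)` (★ `continuous_borelHeight`,
★ A `continuousOn_cpow_two`), and a parametric Bochner integral of a jointly (strongly) measurable integrand is (strongly) measurable (Mathlib `StronglyMeasurable.integral_prod_right'`;
`N(𝔸)` is second countable locally compact, so `ν` is s-finite). [cite: MoeglinWaldspurger1995, II.1.6] -/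
theorem measurable_intertwiningIntegral_param_cm_three (ν : Measure ↥(adelicUnipotent (↥(maximalRealSubfield L)) L (IsCMField.complexConj L) 3)) [ν.IsHaarMeasure]
    {φ' : (quasiSplit (↥(maximalRealSubfield L)) L (IsCMField.complexConj L) 3).Adelic → ℂ} (hφ'c : Continuous φ') (c₀ : ℝ) :
    Measurable fun p : (quasiSplit (↥(maximalRealSubfield L)) L (IsCMField.complexConj L) 3).Adelic × ℝ => ∫ v : ↥(adelicUnipotent (↥(maximalRealSubfield L)) L (IsCMField.complexConj L) 3), flatSectionU φ' ((c₀ : ℂ) + p.2 * I) ((quasiSplit (↥(maximalRealSubfield L)) L (IsCMField.complexConj L) 3).toAdelic (weylLongU ((IsCMField.complexConj L : L ≃ₐ[↥(maximalRealSubfield L)] L) : L →+* L) (rfl : (StdForm.antidiagonal 3).over L = (StdForm.antidiagonal 3).over L)) * (v : (quasiSplit (↥(maximalRealSubfield L)) L (IsCMField.complexConj L) 3).Adelic) * p.1) ∂ν := by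
  haveI := t2Space_adeleRing_of_numberField L
  haveI := locallyCompactSpace_adeleRing' L
  haveI := secondCountableTopology_adeleRing L
  haveI : SecondCountableTopology (quasiSplit (↥(maximalRealSubfield L)) L (IsCMField.complexConj L) 3).Adelic := inferInstanceAs (SecondCountableTopology (adelic (↥(maximalRealSubfield L)) L (IsCMField.complexConj L) 3 ((StdForm.antidiagonal 3).over L)))
  obtain ⟨hN1, hN2⟩ := locallyCompactSpace_and_secondCountableTopology_adelicUnipotent (F := ↥(maximalRealSubfield L)) (E := L) (c := IsCMField.complexConj L) (N := 3)
  haveI := hN1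
  haveI := hN2
  haveI : SigmaFinite ν := inferInstance
  have hW : Continuous fun q : ((quasiSplit (↥(maximalRealSubfield L)) L (IsCMField.complexConj L) 3).Adelic × ℝ) × ↥(adelicUnipotent (↥(maximalRealSubfield L)) L (IsCMField.complexConj L) 3) => (quasiSplit (↥(maximalRealSubfield L)) L (IsCMField.complexConj L) 3).toAdelic (weylLongU ((IsCMField.complexConj L : L ≃ₐ[↥(maximalRealSubfield L)] L) : L →+* L) (rfl : (StdForm.antidiagonal 3).over L = (StdForm.antidiagonal 3).over L)) * (q.2 : (quasiSplit (↥(maximalRealSubfield L)) L (IsCMField.complexConj L) 3).Adelic) * q.1.1 :=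
    (continuous_const.mul (continuous_subtype_val.comp continuous_snd)).mul (continuous_fst.comp continuous_fst)
  have hH : Continuous fun q : ((quasiSplit (↥(maximalRealSubfield L)) L (IsCMField.complexConj L) 3).Adelic × ℝ) × ↥(adelicUnipotent (↥(maximalRealSubfield L)) L (IsCMField.complexConj L) 3) => (borelHeight ((quasiSplit (↥(maximalRealSubfield L)) L (IsCMField.complexConj L) 3).toAdelic (weylLongU ((IsCMField.complexConj L : L ≃ₐ[↥(maximalRealSubfield L)] L) : L →+* L) (rfl : (StdForm.antidiagonal 3).over L = (StdForm.antidiagonal 3).over L)) * (q.2 : (quasiSplit (↥(maximalRealSubfield L)) L (IsCMField.complexConj L) 3).Adelic) * q.1.1) : ℝ) :=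
    NNReal.continuous_coe.comp (continuous_borelHeight.comp hW)
  have hpair : Continuous fun q : ((quasiSplit (↥(maximalRealSubfield L)) L (IsCMField.complexConj L) 3).Adelic × ℝ) × ↥(adelicUnipotent (↥(maximalRealSubfield L)) L (IsCMField.complexConj L) 3) => ((borelHeight ((quasiSplit (↥(maximalRealSubfield L)) L (IsCMField.complexConj L) 3).toAdelic (weylLongU ((IsCMField.complexConj L : L ≃ₐ[↥(maximalRealSubfield L)] L) : L →+* L) (rfl : (StdForm.antidiagonal 3).over L = (StdForm.antidiagonal 3).over L)) * (q.2 : (quasiSplit (↥(maximalRealSubfield L)) L (IsCMField.complexConj L) 3).Adelic) * q.1.1) : ℝ), q.1.2) :=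
    hH.prodMk (continuous_snd.comp continuous_fst)
  have hcpow : Continuous fun q : ((quasiSplit (↥(maximalRealSubfield L)) L (IsCMField.complexConj L) 3).Adelic × ℝ) × ↥(adelicUnipotent (↥(maximalRealSubfield L)) L (IsCMField.complexConj L) 3) => ((borelHeight ((quasiSplit (↥(maximalRealSubfield L)) L (IsCMField.complexConj L) 3).toAdelic (weylLongU ((IsCMField.complexConj L : L ≃ₐ[↥(maximalRealSubfield L)] L) : L →+* L) (rfl : (StdForm.antidiagonal 3).over L = (StdForm.antidiagonal 3).over L)) * (q.2 : (quasiSplit (↥(maximalRealSubfield L)) L (IsCMField.complexConj L) 3).Adelic) * q.1.1) : ℝ) : ℂ) ^ ((c₀ : ℂ) + q.1.2 * I) :=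
    (continuousOn_cpow_two c₀).comp_continuous hpair fun q => ⟨by exact_mod_cast borelHeight_pos _, mem_univ _⟩
  have hcont : Continuous fun q : ((quasiSplit (↥(maximalRealSubfield L)) L (IsCMField.complexConj L) 3).Adelic × ℝ) × ↥(adelicUnipotent (↥(maximalRealSubfield L)) L (IsCMField.complexConj L) 3) => flatSectionU φ' ((c₀ : ℂ) + q.1.2 * I) ((quasiSplit (↥(maximalRealSubfield L)) L (IsCMField.complexConj L) 3).toAdelic (weylLongU ((IsCMField.complexConj L : L ≃ₐ[↥(maximalRealSubfield L)] L) : L →+* L) (rfl : (StdForm.antidiagonal 3).over L = (StdForm.antidiagonal 3).over L)) * (q.2 : (quasiSplit (↥(maximalRealSubfield L)) L (IsCMField.complexConj L) 3).Adelic) * q.1.1) := by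
    simp only [flatSectionU_apply]
    exact (hφ'c.comp hW).mul hcpow
  exact (hcont.stronglyMeasurable.integral_prod_right' (ν := ν)).measurable

/-! ## §3 The uniform bound `‖𝓘_w(g)‖ ≤ C·H(g)^{2−c₀}` on `Re w = c₀ > 2` -/

omit [MeasurableSpace (AdeleRing (𝓞 L) L)ˣ] [BorelSpace (AdeleRing (𝓞 L) L)ˣ] in
/-- **`‖𝓘_w(g)‖ ≤ C_{φ′}·c(c₀)·H(g)^{2−c₀}`** for `Re w = c₀ > 2`, every `g`, with `c(c₀) = ∫_N H(w₀v)^{c₀} dν` independent of `Im w` and `g`: `𝓘_w = flatSectionU 𝓜̃_w (2−w)`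
(★ `flatSectionU_intertwinedCoeff_three_eq`), `‖flatSectionU ψ z g‖ = ‖ψ g‖·H(g)^{Re z}` (★ `norm_flatSectionU`), and ★ `norm_intertwinedCoeff_le_uniform_cm_three`.
[cite: MoeglinWaldspurger1995, II.1.6–II.1.7] [cite: Garrett2018, §2.8] -/
theorem norm_intertwiningIntegral_le_cm_three
    (ν : Measure ↥(adelicUnipotent (↥(maximalRealSubfield L)) L (IsCMField.complexConj L) 3)) [ν.IsHaarMeasure] {𝓕 : Set ↥(adelicUnipotent (↥(maximalRealSubfield L)) L (IsCMField.complexConj L) 3)}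
    (h𝓕N : IsFundamentalDomain ↥(rationalUnipotent (↥(maximalRealSubfield L)) L (IsCMField.complexConj L) 3) 𝓕 ν) (h𝓕c : IsCompact (closure 𝓕))
    {φ' : (quasiSplit (↥(maximalRealSubfield L)) L (IsCMField.complexConj L) 3).Adelic → ℂ} {Cφ' : ℝ} (hφ'C : ∀ x, ‖φ' x‖ ≤ Cφ') {c₀ : ℝ} (hc₀ : 2 < c₀) {w : ℂ} (hw : w.re = c₀) (g : (quasiSplit (↥(maximalRealSubfield L)) L (IsCMField.complexConj L) 3).Adelic) :
    ‖∫ v : ↥(adelicUnipotent (↥(maximalRealSubfield L)) L (IsCMField.complexConj L) 3), flatSectionU φ' w ((quasiSplit (↥(maximalRealSubfield L)) L (IsCMField.complexConj L) 3).toAdelic (weylLongU ((IsCMField.complexConj L : L ≃ₐ[↥(maximalRealSubfield L)] L) : L →+* L) (rfl : (StdForm.antidiagonal 3).over L = (StdForm.antidiagonal 3).over L)) * (v : (quasiSplit (↥(maximalRealSubfield L)) L (IsCMField.complexConj L) 3).Adelic) * g) ∂ν‖ ≤ (Cφ' * ∫ v : ↥(adelicUnipotent (↥(maximalRealSubfield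 L)) L (IsCMField.complexConj L) 3), (borelHeight ((quasiSplit (↥(maximalRealSubfield L)) L (IsCMField.complexConj L) 3).toAdelic (weylLongU ((IsCMField.complexConj L : L ≃ₐ[↥(maximalRealSubfield L)] L) : L →+* L) (rfl : (StdForm.antidiagonal 3).over L = (StdForm.antidiagonal 3).over L)) * (v : (quasiSplit (↥(maximalRealSubfield L)) L (IsCMField.complexConj L) 3).Adelic)) : ℝ) ^ c₀ ∂ν) * (borelHeight g : ℝ) ^ (2 - c₀) := by
  haveI : ν.IsInvInvariant := isInvInvariant_of_isHaarMeasure_adelicUnipotent_three (AlgEquiv.ext fun x => IsCMField.complexConj_apply_apply L x) ν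
  rw [flatSectionU_intertwinedCoeff_three_eq ν φ' w g, norm_flatSectionU, show (2 - w).re = 2 - c₀ by rw [Complex.sub_re, hw]; norm_num]
  exact mul_le_mul_of_nonneg_right (norm_intertwinedCoeff_le_uniform_cm_three L ν h𝓕N h𝓕c hφ'C hc₀ (le_of_eq hw.symm) g) (Real.rpow_nonneg (NNReal.coe_nonneg _) _)

/-! ## §4 `Φ ∈ L¹(ν_G ⊗ dy)` -/

/-- **THE TWO-VARIABLE INTEGRAND IS INTEGRABLE ON `G(𝔸) × ℝ`**: `Φ(g,y) = β(g)•((f∘H)φ(g)·conj 𝓘_{c₀+iy}(g))·conj mellin f′(−(c₀+iy))` with `β` a covering weight, `φ, φ′` continuous bounded,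
`f ∈ C_c((0,∞))`, `f′ ∈ C²_c((0,∞))`, `c₀ > 2`; majorant `(β(g)‖f₂(Hg)‖)·(C_φ C_{φ′} c(c₀)‖mellin f′(−(c₀+iy))‖)`, `f₂ = r^{2−c₀}·f` (§1, §3, ★ A), measurability by §2 (Mathlib `Integrable.mul_prod`,
`Integrable.mono`). [cite: MoeglinWaldspurger1995, II.1.5–II.1.7, II.2.1] -/
theorem integrable_bracketTwoIntegrand_prod_cm_three
    (νG : Measure (quasiSplit (↥(maximalRealSubfield L)) L (IsCMField.complexConj L) 3).Adelic) [νG.IsHaarMeasure] (μK : Measure ((standardMaximalCompactGL 3 L).comap (adelicVal (↥(maximalRealSubfield L)) L (IsCMField.complexConj L) 3 ((StdForm.antidiagonal 3).over L)) : Subgroup (quasiSplit (↥(maximalRealSubfield L)) L (IsCMField.complexConj L) 3).Adelic)) [μK.IsHaarMeasure] (νI : Measure (AdeleRing (𝓞 L) L)ˣ) [νI.IsHaarMeasure]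
    {𝓕I : Set (AdeleRing (𝓞 L) L)ˣ} (h𝓕I : IsIdeleClassDomain L 𝓕I)
    (ν : Measure ↥(adelicUnipotent (↥(maximalRealSubfield L)) L (IsCMField.complexConj L) 3)) [ν.IsHaarMeasure] {𝓕 : Set ↥(adelicUnipotent (↥(maximalRealSubfield L)) L (IsCMField.complexConj L) 3)}
    (h𝓕N : IsFundamentalDomain ↥(rationalUnipotent (↥(maximalRealSubfield L)) L (IsCMField.complexConj L) 3) 𝓕 ν) (h𝓕c : IsCompact (closure 𝓕))
    {β : (quasiSplit (↥(maximalRealSubfield L)) L (IsCMField.complexConj L) 3).Adelic → ℝ≥0∞} (hβ : IsCoveringWeight ((arithmeticBorel (↥(maximalRealSubfield L)) L (IsCMField.complexConj L) 3).map (quasiSplit (↥(maximalRealSubfield L)) L (IsCMField.complexConj L) 3).arithmeticSubgroup.subtype) β)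
    {φ φ' : (quasiSplit (↥(maximalRealSubfield L)) L (IsCMField.complexConj L) 3).Adelic → ℂ} (hφc : Continuous φ) {Cφ : ℝ} (hφC : ∀ x, ‖φ x‖ ≤ Cφ) (hφ'c : Continuous φ') {Cφ' : ℝ} (hφ'C : ∀ x, ‖φ' x‖ ≤ Cφ')
    {f f' : ℝ → ℂ} (hf : Continuous f) (hfs : HasCompactSupport f) (hf0 : tsupport f ⊆ Ioi 0)
    (hf' : ContDiff ℝ 2 f') (hf's : HasCompactSupport f') (hf'0 : tsupport f' ⊆ Ioi 0) {c₀ : ℝ} (hc₀ : 2 < c₀) :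
    Integrable (uncurry fun (g : (quasiSplit (↥(maximalRealSubfield L)) L (IsCMField.complexConj L) 3).Adelic) (y : ℝ) => (β g).toReal • (f (borelHeight g : ℝ) * φ g * conj (∫ v : ↥(adelicUnipotent (↥(maximalRealSubfield L)) L (IsCMField.complexConj L) 3), flatSectionU φ' ((c₀ : ℂ) + y * I) ((quasiSplit (↥(maximalRealSubfield L)) L (IsCMField.complexConj L) 3).toAdelic (weylLongU ((IsCMField.complexConj L : L ≃ₐ[↥(maximalRealSubfield L)] L) : L →+* L) (rfl : (StdForm.antidiagonal 3).over L = (StdForm.antidiagonal 3).over L)) * (v : (quasiSplit (↥(maximalRealSubfield L)) L (IsCMField.complexConj L) 3).Adelic) * g) ∂ν)) * conj (mellin f' (-((c₀ : ℂ) + y * I)))) (νG.prod volume) := by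
  haveI := t2Space_adeleRing_of_numberField L
  haveI := locallyCompactSpace_adeleRing' L
  have hHc : Continuous fun g : (quasiSplit (↥(maximalRealSubfield L)) L (IsCMField.complexConj L) 3).Adelic => (borelHeight g : ℝ) := NNReal.continuous_coe.comp continuous_borelHeight
  have hCφ : 0 ≤ Cφ := (norm_nonneg _).trans (hφC 1)
  -- the radial `L¹` factor with `f₂ = r^{2−c₀}·f`
  have hf₂c : Continuous fun r : ℝ => (r : ℂ) ^ (((2 - c₀ : ℝ)) : ℂ) * f r := continuous_ofReal_cpow_mul hf hf0 _
  have hf₂s : HasCompactSupport fun r : ℝ => (r : ℂ) ^ (((2 - c₀ : ℝ)) : ℂ) * f r := hfs.mul_left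
  have hf₂0 : (tsupport fun r : ℝ => (r : ℂ) ^ (((2 - c₀ : ℝ)) : ℂ) * f r) ⊆ Ioi 0 := tsupport_mul_subset_right.trans hf0
  have hA := integrable_weight_mul_norm_comp_borelHeight_cm_three L νG μK νI h𝓕I hβ hf₂c hf₂s hf₂0
  -- the `L¹(dy)` factor
  have hFi : Integrable fun y : ℝ => mellin f' (-((c₀ : ℂ) + y * I)) := by
    have h := (verticalIntegrable_mellin hf' hf's hf'0 (-c₀)).comp_neg
    refine h.congr (Eventually.of_forall fun y => ?_)
    simp only [ofReal_neg]; congr 1; ring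
  have hG := hA.mul_prod (hFi.norm.const_mul (Cφ * (Cφ' * ∫ v : ↥(adelicUnipotent (↥(maximalRealSubfield L)) L (IsCMField.complexConj L) 3), (borelHeight ((quasiSplit (↥(maximalRealSubfield L)) L (IsCMField.complexConj L) 3).toAdelic (weylLongU ((IsCMField.complexConj L : L ≃ₐ[↥(maximalRealSubfield L)] L) : L →+* L) (rfl : (StdForm.antidiagonal 3).over L = (StdForm.antidiagonal 3).over L)) * (v : (quasiSplit (↥(maximalRealSubfield L)) L (IsCMField.complexConj L) 3).Adelic)) : ℝ) ^ c₀ ∂ν)))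
  -- measurability of `Φ`
  have hβm : Measurable fun p : (quasiSplit (↥(maximalRealSubfield L)) L (IsCMField.complexConj L) 3).Adelic × ℝ => (β p.1).toReal := hβ.measurable.ennreal_toReal.comp measurable_fst
  have hII := measurable_intertwiningIntegral_param_cm_three L ν hφ'c c₀
  have hF : Continuous fun p : (quasiSplit (↥(maximalRealSubfield L)) L (IsCMField.complexConj L) 3).Adelic × ℝ => mellin f' (-((c₀ : ℂ) + p.2 * I)) := (differentiable_mellin hf'.continuous hf's hf'0).continuous.comp (by fun_prop)
  have hmeas : AEStronglyMeasurable (uncurry fun (g : (quasiSplit (↥(maximalRealSubfield L)) L (IsCMField.complexConj L) 3).Adelic) (y : ℝ) => (β g).toReal • (f (borelHeight g : ℝ) * φ g * conj (∫ v : ↥(adelicUnipotent (↥(maximalRealSubfield L)) L (IsCMField.complexConj L) 3), flatSectionU φ' ((c₀ : ℂ) + y * I) ((quasiSplit (↥(maximalRealSubfield L)) L (IsCMField.complexConj L) 3).toAdelic (weylLongU ((IsCMField.complexConj L : L ≃ₐ[↥(maximalRealSubfield L)] L) : L →+* L) (rfl : (StdForm.antidiagonal 3).over L = (StdForm.antidiagonal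 3).over L)) * (v : (quasiSplit (↥(maximalRealSubfield L)) L (IsCMField.complexConj L) 3).Adelic) * g) ∂ν)) * conj (mellin f' (-((c₀ : ℂ) + y * I)))) (νG.prod volume) :=
    ((hβm.aestronglyMeasurable.smul ((((hf.comp hHc).comp continuous_fst).mul (hφc.comp continuous_fst)).aestronglyMeasurable.mul
      (continuous_conj.measurable.comp_aemeasurable hII.aemeasurable).aestronglyMeasurable)).mul (continuous_conj.comp hF).aestronglyMeasurable)
  refine hG.mono hmeas (Eventually.of_forall fun p => ?_)
  obtain ⟨g, y⟩ := p
  have hHpos : 0 < (borelHeight g : ℝ) := by exact_mod_cast borelHeight_pos g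
  have hre : ((c₀ : ℂ) + y * I).re = c₀ := by
    simp only [add_re, ofReal_re, mul_re, I_re, mul_zero, ofReal_im, I_im, mul_one, sub_self, add_zero]
  have hIb := norm_intertwiningIntegral_le_cm_three L ν h𝓕N h𝓕c hφ'C hc₀ hre g
  have hf₂n : ‖(((borelHeight g : ℝ)) : ℂ) ^ (((2 - c₀ : ℝ)) : ℂ) * f (borelHeight g : ℝ)‖ = ‖f (borelHeight g : ℝ)‖ * (borelHeight g : ℝ) ^ (2 - c₀) := by
    rw [norm_mul, Complex.norm_cpow_eq_rpow_re_of_pos hHpos, ofReal_re, mul_comm]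
  have hT : 0 ≤ (β g).toReal * ‖f (borelHeight g : ℝ)‖ * ‖mellin f' (-((c₀ : ℂ) + y * I))‖ := by positivity
  have h1 : ‖φ g‖ * ‖∫ v : ↥(adelicUnipotent (↥(maximalRealSubfield L)) L (IsCMField.complexConj L) 3), flatSectionU φ' ((c₀ : ℂ) + y * I) ((quasiSplit (↥(maximalRealSubfield L)) L (IsCMField.complexConj L) 3).toAdelic (weylLongU ((IsCMField.complexConj L : L ≃ₐ[↥(maximalRealSubfield L)] L) : L →+* L) (rfl : (StdForm.antidiagonal 3).over L = (StdForm.antidiagonal 3).over L)) * (v : (quasiSplit (↥(maximalRealSubfield L)) L (IsCMField.complexConj L) 3).Adelic) * g) ∂ν‖ ≤ Cφ * ((Cφ' * ∫ v : ↥(adelicUnipotent (↥(maximalRealSubfield L)) L (IsCMField.complexConj L) 3), (borelHeight ((quasiSplit (↥(maximalRealSubfield L)) L (IsCMField.complexConj L) 3).toAdelic (weylLongU ((IsCMField.complexConj L : L ≃ₐ[↥(maximalRealSubfield L)] L) : L →+* L) (rfl : (StdForm.antidiagonal 3).over L = (StdForm.antidiagonal 3).over L)) * (v : (quasiSplit (↥(maximalRealSubfield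 L)) L (IsCMField.complexConj L) 3).Adelic)) : ℝ) ^ c₀ ∂ν) * (borelHeight g : ℝ) ^ (2 - c₀)) :=
    mul_le_mul (hφC g) hIb (norm_nonneg _) hCφ
  have hL : ‖(uncurry fun (g : (quasiSplit (↥(maximalRealSubfield L)) L (IsCMField.complexConj L) 3).Adelic) (y : ℝ) => (β g).toReal • (f (borelHeight g : ℝ) * φ g * conj (∫ v : ↥(adelicUnipotent (↥(maximalRealSubfield L)) L (IsCMField.complexConj L) 3), flatSectionU φ' ((c₀ : ℂ) + y * I) ((quasiSplit (↥(maximalRealSubfield L)) L (IsCMField.complexConj L) 3).toAdelic (weylLongU ((IsCMField.complexConj L : L ≃ₐ[↥(maximalRealSubfield L)] L) : L →+* L) (rfl : (StdForm.antidiagonal 3).over L = (StdForm.antidiagonal 3).over L)) * (v : (quasiSplit (↥(maximalRealSubfield L)) L (IsCMField.complexConj L) 3).Adelic) * g) ∂ν)) * conj (mellin f' (-((c₀ : ℂ) + y * I)))) (g, y)‖ =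
      (β g).toReal * ‖f (borelHeight g : ℝ)‖ * ‖mellin f' (-((c₀ : ℂ) + y * I))‖ * (‖φ g‖ * ‖∫ v : ↥(adelicUnipotent (↥(maximalRealSubfield L)) L (IsCMField.complexConj L) 3), flatSectionU φ' ((c₀ : ℂ) + y * I) ((quasiSplit (↥(maximalRealSubfield L)) L (IsCMField.complexConj L) 3).toAdelic (weylLongU ((IsCMField.complexConj L : L ≃ₐ[↥(maximalRealSubfield L)] L) : L →+* L) (rfl : (StdForm.antidiagonal 3).over L = (StdForm.antidiagonal 3).over L)) * (v : (quasiSplit (↥(maximalRealSubfield L)) L (IsCMField.complexConj L) 3).Adelic) * g) ∂ν‖) := by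
    simp only [uncurry_apply_pair, norm_mul, norm_smul, RCLike.norm_conj, Real.norm_of_nonneg ENNReal.toReal_nonneg]
    ring
  have hR : ‖(fun p : (quasiSplit (↥(maximalRealSubfield L)) L (IsCMField.complexConj L) 3).Adelic × ℝ => (β p.1).toReal * ‖(((borelHeight p.1 : ℝ)) : ℂ) ^ (((2 - c₀ : ℝ)) : ℂ) * f (borelHeight p.1 : ℝ)‖ * (Cφ * (Cφ' * ∫ v : ↥(adelicUnipotent (↥(maximalRealSubfield L)) L (IsCMField.complexConj L) 3), (borelHeight ((quasiSplit (↥(maximalRealSubfield L)) L (IsCMField.complexConj L) 3).toAdelic (weylLongU ((IsCMField.complexConj L : L ≃ₐ[↥(maximalRealSubfield L)] L) : L →+* L) (rfl : (StdForm.antidiagonal 3).over L = (StdForm.antidiagonal 3).over L)) * (v : (quasiSplit (↥(maximalRealSubfield L)) L (IsCMField.complexConj L) 3).Adelic)) : ℝ) ^ c₀ ∂ν) * ‖mellin f' (-((c₀ : ℂ) + p.2 * I))‖)) (g, y)‖ =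
      (β g).toReal * ‖f (borelHeight g : ℝ)‖ * ‖mellin f' (-((c₀ : ℂ) + y * I))‖ * (Cφ * ((Cφ' * ∫ v : ↥(adelicUnipotent (↥(maximalRealSubfield L)) L (IsCMField.complexConj L) 3), (borelHeight ((quasiSplit (↥(maximalRealSubfield L)) L (IsCMField.complexConj L) 3).toAdelic (weylLongU ((IsCMField.complexConj L : L ≃ₐ[↥(maximalRealSubfield L)] L) : L →+* L) (rfl : (StdForm.antidiagonal 3).over L = (StdForm.antidiagonal 3).over L)) * (v : (quasiSplit (↥(maximalRealSubfield L)) L (IsCMField.complexConj L) 3).Adelic)) : ℝ) ^ c₀ ∂ν) * (borelHeight g : ℝ) ^ (2 - c₀))) := by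
    have hnn : 0 ≤ (β g).toReal * ‖(((borelHeight g : ℝ)) : ℂ) ^ (((2 - c₀ : ℝ)) : ℂ) * f (borelHeight g : ℝ)‖ * (Cφ * (Cφ' * ∫ v : ↥(adelicUnipotent (↥(maximalRealSubfield L)) L (IsCMField.complexConj L) 3), (borelHeight ((quasiSplit (↥(maximalRealSubfield L)) L (IsCMField.complexConj L) 3).toAdelic (weylLongU ((IsCMField.complexConj L : L ≃ₐ[↥(maximalRealSubfield L)] L) : L →+* L) (rfl : (StdForm.antidiagonal 3).over L = (StdForm.antidiagonal 3).over L)) * (v : (quasiSplit (↥(maximalRealSubfield L)) L (IsCMField.complexConj L) 3).Adelic)) : ℝ) ^ c₀ ∂ν) * ‖mellin f' (-((c₀ : ℂ) + y * I))‖) :=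
      mul_nonneg (mul_nonneg ENNReal.toReal_nonneg (norm_nonneg _)) (mul_nonneg (mul_nonneg hCφ (mul_nonneg ((norm_nonneg _).trans (hφ'C 1)) (integral_nonneg fun v => Real.rpow_nonneg (NNReal.coe_nonneg _) _))) (norm_nonneg _))
    rw [Real.norm_of_nonneg hnn, hf₂n]
    ring
  rw [hL, hR]
  exact mul_le_mul_of_nonneg_left h1 hT

/-! ## §5 HEAD: the swap -/

/-- **hFub-c1 — THE SECOND FUBINI SWAP.**  With the data of §4 and any real `r` (`= (ν𝓕)⁻¹`):
**`∫ β•((f∘H)φ·conj(r•((2π)⁻¹∫_ℝ mellin f′(−w_y)·𝓘_{w_y} dy))) dν_G = (r(2π)⁻¹)·∫_ℝ (∫ β•((f∘H)φ·conj 𝓘_{w_y}) dν_G)·conj(mellin f′(−w_y)) dy`** (`w_y = c₀+iy`) — `conj` through the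
`y`-integral (`integral_conj`), constants out, Mathlib `integral_integral_swap` on §4's `L¹(ν_G ⊗ dy)` integrand.  The left side is `[Ψ₂]_β` after ★ hFub-b p865376; the inner integrals on the
right are the `w`-slices of ★ hFub-c2∕c3 p865445. [cite: MoeglinWaldspurger1995, II.2.1] [cite: Rogawski1990, §7.3 (pp. 96–98)] -/
theorem integral_weight_smul_conj_mellinIntertwined_eq_integral_slice_cm_three
    (νG : Measure (quasiSplit (↥(maximalRealSubfield L)) L (IsCMField.complexConj L) 3).Adelic) [νG.IsHaarMeasure] (μK : Measure ((standardMaximalCompactGL 3 L).comap (adelicVal (↥(maximalRealSubfield L)) L (IsCMField.complexConj L) 3 ((StdForm.antidiagonal 3).over L)) : Subgroup (quasiSplit (↥(maximalRealSubfield L)) L (IsCMField.complexConj L) 3).Adelic)) [μK.IsHaarMeasure] (νI : Measure (AdeleRing (𝓞 L) L)ˣ) [νI.IsHaarMeasure]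
    {𝓕I : Set (AdeleRing (𝓞 L) L)ˣ} (h𝓕I : IsIdeleClassDomain L 𝓕I)
    (ν : Measure ↥(adelicUnipotent (↥(maximalRealSubfield L)) L (IsCMField.complexConj L) 3)) [ν.IsHaarMeasure] {𝓕 : Set ↥(adelicUnipotent (↥(maximalRealSubfield L)) L (IsCMField.complexConj L) 3)}
    (h𝓕N : IsFundamentalDomain ↥(rationalUnipotent (↥(maximalRealSubfield L)) L (IsCMField.complexConj L) 3) 𝓕 ν) (h𝓕c : IsCompact (closure 𝓕))
    {β : (quasiSplit (↥(maximalRealSubfield L)) L (IsCMField.complexConj L) 3).Adelic → ℝ≥0∞} (hβ : IsCoveringWeight ((arithmeticBorel (↥(maximalRealSubfield L)) L (IsCMField.complexConj L) 3).map (quasiSplit (↥(maximalRealSubfield L)) L (IsCMField.complexConj L) 3).arithmeticSubgroup.subtype) β)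
    {φ φ' : (quasiSplit (↥(maximalRealSubfield L)) L (IsCMField.complexConj L) 3).Adelic → ℂ} (hφc : Continuous φ) {Cφ : ℝ} (hφC : ∀ x, ‖φ x‖ ≤ Cφ) (hφ'c : Continuous φ') {Cφ' : ℝ} (hφ'C : ∀ x, ‖φ' x‖ ≤ Cφ')
    {f f' : ℝ → ℂ} (hf : Continuous f) (hfs : HasCompactSupport f) (hf0 : tsupport f ⊆ Ioi 0)
    (hf' : ContDiff ℝ 2 f') (hf's : HasCompactSupport f') (hf'0 : tsupport f' ⊆ Ioi 0) {c₀ : ℝ} (hc₀ : 2 < c₀) (r : ℝ) :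
    ∫ g : (quasiSplit (↥(maximalRealSubfield L)) L (IsCMField.complexConj L) 3).Adelic, (β g).toReal • (f (borelHeight g : ℝ) * φ g *
        conj (r • ((((2 * π)⁻¹ : ℝ) : ℂ) * ∫ y : ℝ, mellin f' (-((c₀ : ℂ) + y * I)) * ∫ v : ↥(adelicUnipotent (↥(maximalRealSubfield L)) L (IsCMField.complexConj L) 3), flatSectionU φ' ((c₀ : ℂ) + y * I) ((quasiSplit (↥(maximalRealSubfield L)) L (IsCMField.complexConj L) 3).toAdelic (weylLongU ((IsCMField.complexConj L : L ≃ₐ[↥(maximalRealSubfield L)] L) : L →+* L) (rfl : (StdForm.antidiagonal 3).over L = (StdForm.antidiagonal 3).over L)) * (v : (quasiSplit (↥(maximalRealSubfield L)) L (IsCMField.complexConj L) 3).Adelic) * g) ∂ν))) ∂νG =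
      ((r : ℂ) * (((2 * π)⁻¹ : ℝ) : ℂ)) * ∫ y : ℝ, (∫ g : (quasiSplit (↥(maximalRealSubfield L)) L (IsCMField.complexConj L) 3).Adelic, (β g).toReal • (f (borelHeight g : ℝ) * φ g * conj (∫ v : ↥(adelicUnipotent (↥(maximalRealSubfield L)) L (IsCMField.complexConj L) 3), flatSectionU φ' ((c₀ : ℂ) + y * I) ((quasiSplit (↥(maximalRealSubfield L)) L (IsCMField.complexConj L) 3).toAdelic (weylLongU ((IsCMField.complexConj L : L ≃ₐ[↥(maximalRealSubfield L)] L) : L →+* L) (rfl : (StdForm.antidiagonal 3).over L = (StdForm.antidiagonal 3).over L)) * (v : (quasiSplit (↥(maximalRealSubfield L)) L (IsCMField.complexConj L) 3).Adelic) * g) ∂ν)) ∂νG) * conj (mellin f' (-((c₀ : ℂ) + y * I))) := by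
  haveI := t2Space_adeleRing_of_numberField L
  haveI := locallyCompactSpace_adeleRing' L
  haveI := secondCountableTopology_adeleRing L
  haveI : SecondCountableTopology (quasiSplit (↥(maximalRealSubfield L)) L (IsCMField.complexConj L) 3).Adelic := inferInstanceAs (SecondCountableTopology (adelic (↥(maximalRealSubfield L)) L (IsCMField.complexConj L) 3 ((StdForm.antidiagonal 3).over L)))
  haveI : LocallyCompactSpace (quasiSplit (↥(maximalRealSubfield L)) L (IsCMField.complexConj L) 3).Adelic := inferInstanceAs (LocallyCompactSpace (adelic (↥(maximalRealSubfield L)) L (IsCMField.complexConj L) 3 ((StdForm.antidiagonal 3).over L)))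
  haveI : SigmaFinite νG := inferInstance
  have hInt := integrable_bracketTwoIntegrand_prod_cm_three L νG μK νI h𝓕I ν h𝓕N h𝓕c hβ hφc hφC hφ'c hφ'C hf hfs hf0 hf' hf's hf'0 hc₀
  -- pointwise in `g`: `conj` through the `y`-integral and the constants out
  have hpt : ∀ g : (quasiSplit (↥(maximalRealSubfield L)) L (IsCMField.complexConj L) 3).Adelic, (β g).toReal • (f (borelHeight g : ℝ) * φ g *
        conj (r • ((((2 * π)⁻¹ : ℝ) : ℂ) * ∫ y : ℝ, mellin f' (-((c₀ : ℂ) + y * I)) * ∫ v : ↥(adelicUnipotent (↥(maximalRealSubfield L)) L (IsCMField.complexConj L) 3), flatSectionU φ' ((c₀ : ℂ) + y * I) ((quasiSplit (↥(maximalRealSubfield L)) L (IsCMField.complexConj L) 3).toAdelic (weylLongU ((IsCMField.complexConj L : L ≃ₐ[↥(maximalRealSubfield L)] L) : L →+* L) (rfl : (StdForm.antidiagonal 3).over L = (StdForm.antidiagonal 3).over L)) * (v : (quasiSplit (↥(maximalRealSubfield L)) L (IsCMField.complexConj L) 3).Adelic) * g) ∂ν))) =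
      ((r : ℂ) * (((2 * π)⁻¹ : ℝ) : ℂ)) * ∫ y : ℝ, (β g).toReal • (f (borelHeight g : ℝ) * φ g * conj (∫ v : ↥(adelicUnipotent (↥(maximalRealSubfield L)) L (IsCMField.complexConj L) 3), flatSectionU φ' ((c₀ : ℂ) + y * I) ((quasiSplit (↥(maximalRealSubfield L)) L (IsCMField.complexConj L) 3).toAdelic (weylLongU ((IsCMField.complexConj L : L ≃ₐ[↥(maximalRealSubfield L)] L) : L →+* L) (rfl : (StdForm.antidiagonal 3).over L = (StdForm.antidiagonal 3).over L)) * (v : (quasiSplit (↥(maximalRealSubfield L)) L (IsCMField.complexConj L) 3).Adelic) * g) ∂ν)) * conj (mellin f' (-((c₀ : ℂ) + y * I))) := fun g => by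
    have hJ : ∫ y : ℝ, (β g).toReal • (f (borelHeight g : ℝ) * φ g * conj (∫ v : ↥(adelicUnipotent (↥(maximalRealSubfield L)) L (IsCMField.complexConj L) 3), flatSectionU φ' ((c₀ : ℂ) + y * I) ((quasiSplit (↥(maximalRealSubfield L)) L (IsCMField.complexConj L) 3).toAdelic (weylLongU ((IsCMField.complexConj L : L ≃ₐ[↥(maximalRealSubfield L)] L) : L →+* L) (rfl : (StdForm.antidiagonal 3).over L = (StdForm.antidiagonal 3).over L)) * (v : (quasiSplit (↥(maximalRealSubfield L)) L (IsCMField.complexConj L) 3).Adelic) * g) ∂ν)) * conj (mellin f' (-((c₀ : ℂ) + y * I))) =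
        ((β g).toReal • (f (borelHeight g : ℝ) * φ g)) * ∫ y : ℝ, conj (mellin f' (-((c₀ : ℂ) + y * I)) * ∫ v : ↥(adelicUnipotent (↥(maximalRealSubfield L)) L (IsCMField.complexConj L) 3), flatSectionU φ' ((c₀ : ℂ) + y * I) ((quasiSplit (↥(maximalRealSubfield L)) L (IsCMField.complexConj L) 3).toAdelic (weylLongU ((IsCMField.complexConj L : L ≃ₐ[↥(maximalRealSubfield L)] L) : L →+* L) (rfl : (StdForm.antidiagonal 3).over L = (StdForm.antidiagonal 3).over L)) * (v : (quasiSplit (↥(maximalRealSubfield L)) L (IsCMField.complexConj L) 3).Adelic) * g) ∂ν) := by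
      rw [← integral_const_mul]
      refine integral_congr_ae (Eventually.of_forall fun y => ?_)
      dsimp only
      simp only [map_mul, Complex.real_smul]
      ring
    rw [hJ, integral_conj]
    simp only [Complex.real_smul, map_mul, Complex.conj_ofReal]
    ring
  simp_rw [hpt]
  rw [integral_const_mul, integral_integral_swap hInt]
  congr 1
  refine integral_congr_ae (Eventually.of_forall fun y => ?_)
  dsimp only
  rw [integral_mul_const]

end Summit.HodgeConjecture.HodgeConjecture.Cruxes.H413.K2E1ChiPseudoEisensteinBracketTwoFubiniCMThree

end
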